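import Literature.IUT.LogThetaLattice.PrimeStripGroupoids
import HarnessLib

/-!
# Bridge B10 (part 1b): per-place evaluation functors and the groupoid of Θ-Hodge theaters over the kits

Mochizuki, *Inter-universal Teichmüller Theory I*, kurims manuscript (May 2020), Def 3.6 p.87, Def 4.1 (i) p.95,
Def 5.2 (i)–(iii) p.134, Rmk 5.2.1 (i)(ii) p.143, the discussion preceding Ex 5.4 p.147, Cor 5.6 (i) p.153
[cite: Mochizuki2012, I Def 3.6 p.87, Def 5.2 (iii) p.134, Rmk 5.2.1 p.143, Cor 5.6 (i) p.153]
(D-0012 claim key, status disputed; BRIDGE plumbing over landed typings — nothing of the series is asserted).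

Companion of `PrimeStripGroupoids.lean` (MERGE-MAP plan/L6/MERGE-MAP.md §8 B10; abc-iut-L6-t3's `StripFrame.ofKits`
and `LogStripData.ofKits` are the consumers): (1) the constituent-at-`v` functors `evalF v : FK.FStrip ⥤ FK.FAmb v`,
`evalFm v`, `evalD v : K.DStrip ⥤ K.Amb v` out of the prime-strip groupoids, with the definitional squares
`assocDFunctor ⋙ evalD v = evalF v ⋙ FK.toD v` and `monoFunctor ⋙ evalFm v = evalF v ⋙ FK.toFm v` (a log-link or
any other per-place construction on strips is assembled place by place through these); (2) abc-iut-L5-t4's Θ-Hodge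
theaters `FKit.ThetaHT` ([IUTchI] Def 3.6) with their isomorphisms `ThetaHT.Iso` (Cor 5.6 (i)) as a GROUPOID
(`refl`/`trans`/`symm` of the landed record — the compatibility squares with the `ℱ^⊢`-prime-strips compose), and
"the `ℱ`-prime-strip tautologically associated to this Θ-Hodge theater" `†ℋ𝒯^Θ ↦ †𝔉_>` as a FUNCTOR
`fStripFunctor : FK.ThetaHT ⥤ FK.FStrip`, whose composite with `assocDFunctor` is, on isomorphisms, L5-t4's
"natural functorially induced map" `ThetaHT.isoToD` of Cor 5.6 (i) (by `rfl`).
-/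

namespace Literature.IUT.LogThetaLattice

open CategoryTheory
open Literature.IUT.HodgeTheaters

universe u

namespace PrimeStripGroupoids

variable {l : ℕ} {K : PMBaseKit.{u} l} {M : K.MultKit} {FK : K.FKit M}

/-! ### Per-place evaluation functors (the constituent at `v`) -/

variable (FK) in
/-- **IUTchI:Def5.2(i)** (kurims p.134) The constituent `‡ℱ_v` of an `ℱ`-prime-strip at `v`, functorially: `FK.FStrip ⥤ FK.FAmb v`
(a morphism of strips is a collection of isomorphisms; its `v`-component's underlying morphism).
[claim: Mochizuki2012, status: disputed] -/
def evalF (v : K.V) : FK.FStrip ⥤ FK.FAmb v where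
  obj F := F.obj v
  map φ := (φ v).hom

variable (FK) in
/-- **IUTchI:Def5.2(ii)** (kurims p.134) The constituent `‡ℱ^⊢_v` of an `ℱ^⊢`-prime-strip at `v`, functorially.
[claim: Mochizuki2012, status: disputed] -/
def evalFm (v : K.V) : FK.FmStrip ⥤ FK.FmAmb v where
  obj F := F.obj v
  map φ := (φ v).hom

variable (K) in
/-- **IUTchI:Def4.1(i)** (kurims p.95) The constituent `†𝒟_v` of a `𝒟`-prime-strip at `v`, functorially (into the ambient category
`K.Amb v` of abc-iut-L5-t4's kit). [claim: Mochizuki2012, status: disputed] -/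
def evalD (v : K.V) : K.DStrip ⥤ K.Amb v where
  obj D := D.obj v
  map φ := (φ v).hom

/-- **IUTchI:Rmk5.2.1(i)** (kurims p.143) `𝔉 ↦ 𝔇` is, at each `v`, L5-t4's base functor `FK.toD v`: the square of functors
`assocDFunctor ⋙ evalD v = evalF v ⋙ FK.toD v` commutes ON THE NOSE (definitional). [claim: Mochizuki2012, status: disputed] -/
theorem assocDFunctor_comp_evalD (v : K.V) : assocDFunctor FK ⋙ evalD K v = evalF FK v ⋙ FK.toD v := rfl

/-- **IUTchI:Rmk5.2.1(ii)** (kurims p.143) `𝔉 ↦ 𝔉^⊢` is, at each `v`, L5-t4's `FK.toFm v`: `monoFunctor ⋙ evalFm v = evalF v ⋙ FK.toFm v`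
ON THE NOSE. [claim: Mochizuki2012, status: disputed] -/
theorem monoFunctor_comp_evalFm (v : K.V) : monoFunctor FK ⋙ evalFm FK v = evalF FK v ⋙ FK.toFm v := rfl

/-! ### Θ-Hodge theaters ([IUTchI] Def 3.6) as a groupoid; `†𝔉_>`, `†𝔇_>` as functors (Cor 5.6 (i) shape) -/

/-- **IUTchI:Cor5.6(i)** (kurims p.153) Extensionality for L5-t4's isomorphisms of Θ-Hodge theaters: determined by their data
(`thIso`, `rlfIso`; `compat` is a proposition). [claim: Mochizuki2012, status: disputed] -/
theorem ThetaHT.Iso.ext' {H₁ H₂ : FK.ThetaHT} {φ ψ : PMBaseKit.FKit.ThetaHT.Iso H₁ H₂}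
    (hth : φ.thIso = ψ.thIso) (hrlf : φ.rlfIso = ψ.rlfIso) : φ = ψ := by
  cases φ; cases ψ; cases hth; cases hrlf; rfl

/-- **IUTchI:Cor5.6(i)** (kurims p.153) The identity isomorphism of a Θ-Hodge theater. [claim: Mochizuki2012, status: disputed] -/
def ThetaHT.Iso.refl (H : FK.ThetaHT) : PMBaseKit.FKit.ThetaHT.Iso H H where
  thIso v := CategoryTheory.Iso.refl _
  rlfIso := CategoryTheory.Iso.refl _
  compat v := by simp

/-- **IUTchI:Cor5.6(i)** (kurims p.153) Composition of isomorphisms of Θ-Hodge theaters (the compatibility squares compose).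
[claim: Mochizuki2012, status: disputed] -/
def ThetaHT.Iso.trans {H₁ H₂ H₃ : FK.ThetaHT} (φ : PMBaseKit.FKit.ThetaHT.Iso H₁ H₂)
    (ψ : PMBaseKit.FKit.ThetaHT.Iso H₂ H₃) : PMBaseKit.FKit.ThetaHT.Iso H₁ H₃ where
  thIso v := φ.thIso v ≪≫ ψ.thIso v
  rlfIso := φ.rlfIso ≪≫ ψ.rlfIso
  compat v := by
    simp only [Iso.trans_hom, Functor.map_comp, Category.assoc]
    rw [ψ.compat v, ← Category.assoc, φ.compat v, Category.assoc]

/-- **IUTchI:Cor5.6(i)** (kurims p.153) The inverse of an isomorphism of Θ-Hodge theaters. [claim: Mochizuki2012, status: disputed] -/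
def ThetaHT.Iso.symm {H₁ H₂ : FK.ThetaHT} (φ : PMBaseKit.FKit.ThetaHT.Iso H₁ H₂) :
    PMBaseKit.FKit.ThetaHT.Iso H₂ H₁ where
  thIso v := (φ.thIso v).symm
  rlfIso := φ.rlfIso.symm
  compat v := by
    have h' : ((FK.rlfFm v).mapIso φ.rlfIso).hom ≫ (H₂.rlf_fm v).hom =
        (H₁.rlf_fm v).hom ≫ ((FK.toFm v).mapIso ((FK.thToF v).mapIso (φ.thIso v))).hom := φ.compat v
    change ((FK.rlfFm v).mapIso φ.rlfIso).inv ≫ (H₁.rlf_fm v).hom =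
      (H₂.rlf_fm v).hom ≫ ((FK.toFm v).mapIso ((FK.thToF v).mapIso (φ.thIso v))).inv
    rw [Iso.inv_comp_eq]
    simp only [← Category.assoc]
    rw [Iso.eq_comp_inv]
    exact h'.symm

/-- **IUTchI:Def3.6** (kurims p.87) The groupoid of Θ-Hodge theaters over the kit (`Hom := ThetaHT.Iso` of abc-iut-L5-t4).
[claim: Mochizuki2012, status: disputed] -/
instance instGroupoidThetaHT : Groupoid FK.ThetaHT where
  Hom H₁ H₂ := PMBaseKit.FKit.ThetaHT.Iso H₁ H₂
  id H := ThetaHT.Iso.refl H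
  comp φ ψ := ThetaHT.Iso.trans φ ψ
  inv φ := ThetaHT.Iso.symm φ
  id_comp φ := ThetaHT.Iso.ext' (funext fun v => Iso.refl_trans (φ.thIso v)) (Iso.refl_trans φ.rlfIso)
  comp_id φ := ThetaHT.Iso.ext' (funext fun v => Iso.trans_refl (φ.thIso v)) (Iso.trans_refl φ.rlfIso)
  assoc φ ψ χ := ThetaHT.Iso.ext' (funext fun v => Iso.trans_assoc (φ.thIso v) (ψ.thIso v) (χ.thIso v))
    (Iso.trans_assoc φ.rlfIso ψ.rlfIso χ.rlfIso)
  inv_comp φ := ThetaHT.Iso.ext' (funext fun v => Iso.symm_self_id (φ.thIso v)) (Iso.symm_self_id φ.rlfIso)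
  comp_inv φ := ThetaHT.Iso.ext' (funext fun v => Iso.self_symm_id (φ.thIso v)) (Iso.self_symm_id φ.rlfIso)

variable (FK) in
/-- **IUTchI:Ex5.4** (kurims p.147) `†ℋ𝒯^Θ ↦ †𝔉_>`, "the `ℱ`-prime-strip tautologically associated to this Θ-Hodge theater", as a FUNCTOR
(L5-t4's `ThetaHT.fStrip` on objects, `thToF` componentwise on isomorphisms). [claim: Mochizuki2012, status: disputed] -/
noncomputable def fStripFunctor : FK.ThetaHT ⥤ FK.FStrip where
  obj H := H.fStrip
  map φ := fun v => (FK.thToF v).mapIso (φ.thIso v)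
  map_id H := by
    funext v
    change (FK.thToF v).mapIso (CategoryTheory.Iso.refl _) = CategoryTheory.Iso.refl _
    exact (FK.thToF v).mapIso_refl _
  map_comp φ ψ := by
    funext v
    change (FK.thToF v).mapIso (φ.thIso v ≪≫ ψ.thIso v) =
      (FK.thToF v).mapIso (φ.thIso v) ≪≫ (FK.thToF v).mapIso (ψ.thIso v)
    exact (FK.thToF v).mapIso_trans _ _

/-- **IUTchI:Cor5.6(i)** (kurims p.153) `†ℋ𝒯^Θ ↦ †𝔇_>` as a functor is `fStripFunctor ⋙ assocDFunctor`, and on isomorphisms it IS L5-t4's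
«natural functorially induced map» `ThetaHT.isoToD`. [claim: Mochizuki2012, status: disputed] -/
theorem fStripFunctor_assocD_map {H₁ H₂ : FK.ThetaHT} (φ : H₁ ⟶ H₂) :
    (fStripFunctor FK ⋙ assocDFunctor FK).map φ = PMBaseKit.FKit.ThetaHT.isoToD φ := rfl

/-- **IUTchI:Def3.6** (kurims p.87) Any two Θ-Hodge theaters over the kit are isomorphic whenever their global realified data are
compatibly isomorphic — in particular each is isomorphic to itself (non-emptiness of `Aut`); full connectedness
needs the rigidity of the `rlf_fm` identifications and is NOT asserted here. [claim: Mochizuki2012, status: disputed] -/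
theorem iso_nonempty_ThetaHT_self (H : FK.ThetaHT) : Nonempty (H ≅ H) := ⟨Iso.refl H⟩


end PrimeStripGroupoids

end Literature.IUT.LogThetaLattice
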